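import Summits.HodgeConjecture.HodgeConjecture.Theorems.MarkmanPartnerTransportK3Sq2KugaSatakeMixedEndomorphisms
import Summits.HodgeConjecture.HodgeConjecture.Theorems.MarkmanPartnerTransportPicardThreeK3SquaresKugaSatakePairDescent
import Summits.HodgeConjecture.HodgeConjecture.Theorems.MarkmanPartnerTransportPicardThreeK3SquaresKugaSatakePairClassMap
import Summits.HodgeConjecture.HodgeConjecture.Theorems.MarkmanPartnerTransportPicardThreeK3SquaresCycleInducedSector
import Summits.HodgeConjecture.HodgeConjecture.Theorems.Ring2AbelianAllAndrePrimitiveProjectorAlgebraic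

/-!
# Route MarkmanPartnerTransport · crux #4 `PicardThreeK3Squares` (stmt-HodgeConjecture-19652) — HC⁴ OF THE SQUARE IS
# INVARIANT ALONG ANY ALGEBRAIC CORRESPONDENCE BETWEEN SURFACES WITH `h^{2,0} = 1` THAT DOES NOT KILL THE PERIOD
# (UNCONDITIONAL: no named fact)

`hodgeConjectureFor_square_of_algebraicCorrespondence₂`: let `S`, `S'` be smooth projective surfaces whose
`(2,0)`-classes form lines `ℂσ ≠ 0`, `ℂσ' ≠ 0`, and `Φ : H²(S(ℂ); ℂ) → H²(S'(ℂ); ℂ)` ANY map INDUCED BY AN ALGEBRAIC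
CYCLE on `S' × S` with `Φ σ ≠ 0` (a dominant rational map `S ⇢ S'`, a quotient map, an isogeny realised by a cycle,
a Kuga–Satake or Fourier–Mukai correspondence, …). Then `HodgeConjectureFor 4 (S ⊗ S) → HodgeConjectureFor 4 (S' ⊗ S')`,
with NO named fact. The surface-to-surface form of `KugaSatakeMixed.hodgeConjectureFor_of_square_of_algebraicCorrespondence`
(there the target is a `K3^{[2]}`-type fourfold and three records are needed); it generalises, fact-free, the tree's
isogeny invariance (gen 3, mod Buskin), quotient descents (gens 3–5) and similitude invariance (gen 15, mod Kuga–Satake)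
of HC⁴ for K3 squares: the open residue of crux #4 is closed under such correspondences in both directions (apply the
theorem to the transpose, which does not kill `σ'` by Hodge–Riemann).

Proof (Schur ∕ subfield transport): rational descent of `Φ` through a retraction `ℂ → ℚ` gives an INJECTIVE Hodge
morphism `a : T(S)_ℚ → T(S')_ℚ` induced by a rational combination `f₁` of correspondences (irreducibility of
`T(S)_ℚ`); the Lefschetz transpose `ᵗf₁` (Hodge–Riemann, `exists_lefschetzTranspose₂`) descends to an injective
`b : T(S')_ℚ → T(S)_ℚ` induced by correspondences `S' → S`; `u := a ∘ b ∈ E(S') = End_Hdg T(S')_ℚ` (a FIELD, Zarhin) is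
cycle-induced and injective; for a route endomorphism `f` of `H²(S')`, `b ∘ f_T ∘ a ∈ E(S)` is cycle-induced by
HC⁴(S × S) (Voisin I Lemma 11.41, `exists_corr_eq_of_mem_endAlg_of_hodgeConjectureFor_square`), so
`u ∘ f_T ∘ u = (u ∘ u) ∘ f_T` is, and the subfield trick makes `f_T` cycle-induced — the cycle-induced sector clause of
`CycleInducedSector.hodgeConjectureFor_square_of_cycleInducedSector`, which returns HC⁴(S' × S').

THEOREMS ONLY; no sorry, no definition, no named fact, NO hypothesis beyond the displayed data; nothing here says the
crux or HC is proved. Prover seat hodge-nonav-19652-p1 (gen 16), `--supports stmt-HodgeConjecture-19652`.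

References: C. Voisin, *Hodge Theory I* Lemma 7.25, Lemma 11.41, §6.3.2; Yu. Zarhin, J. reine angew. Math. 341 (1983)
Thm. 1.5.1; D. Huybrechts, Comment. Math. Helv. 94 (2019) Rem. 3.3; M. Varesco, Math. Z. 305 (2023) §2 (p. 8);
W. Fulton, *Intersection Theory* §16.1.
-/

set_option linter.dupNamespace false

noncomputable section

namespace Summit.HodgeConjecture.HodgeConjecture.Theorems.MarkmanPartnerTransport.SquareTransport

open scoped TensorProduct
open CategoryTheory MonoidalCategory Literature.AlgebraicGeometry Literature.AlgebraicGeometry.Motives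
open Literature.AlgebraicGeometry.HodgeTheory Literature.AlgebraicTopology.SingularHomology
open Literature.AlgebraicGeometry.Motives.HodgeStructure
open Literature.AlgebraicGeometry.Surfaces
open Summit.HodgeConjecture.HodgeConjecture.Ring2.AbelianAll
open Summit.HodgeConjecture.HodgeConjecture.Theorems.OddPrimeSquares
open Summit.HodgeConjecture.HodgeConjecture.Theorems.NikulinTwinTransport
open Summit.HodgeConjecture.HodgeConjecture.Theorems.MarkmanPartnerTransport.TranscendentalPresentation
open Summit.HodgeConjecture.HodgeConjecture.Theorems.MarkmanPartnerTransport.KugaSatakeSelf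
open Summit.HodgeConjecture.HodgeConjecture.Theorems.MarkmanPartnerTransport.KugaSatakePair
open Summit.HodgeConjecture.HodgeConjecture.Theorems.MarkmanPartnerTransport.KugaSatakeMixed
open Summit.HodgeConjecture.HodgeConjecture.Theorems.MarkmanPartnerTransport.CycleInducedSector

variable {S S' : SchemeOver ℂ}

/-- `H²[hS]`: the weight-two `ℚ`-Hodge structure on `H²(S(ℂ); ℚ)` of the real Hodge model of the surface `S`. -/
local notation3 "H²[" hS "]" =>
  bettiTwoHodgeStructure hS (BettiUniverse.realHodgeModel exists_isReal_hodgeModel_holds hS)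
    (BettiUniverse.realHodgeModel_isHodgeSymmetric exists_isReal_hodgeModel_holds hS)

/-- `T[hS] = T(S)_ℚ = Hdg¹^⊥ ⊆ H²(S(ℂ); ℚ)`. -/
local notation3 "T[" hS "]" =>
  transcendentalLatticeBetti hS (BettiUniverse.realHodgeModel exists_isReal_hodgeModel_holds hS)
    (BettiUniverse.realHodgeModel_isHodgeSymmetric exists_isReal_hodgeModel_holds hS)

/-- `Θ : ℂ ⊗_ℚ H²(Y(ℂ); ℚ) → H²(Y(ℂ); ℂ)`. -/
local notation3 "Θ[" Y "]" => ofRatClassBaseChange (Motives.ComplexPoints Y) (2 * 1)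

/-- `ι : H²(Y(ℂ); ℚ) → H²(Y(ℂ); ℂ)`, the rational lattice. -/
local notation3 "ι[" Y "]" => ofRatClass (Motives.ComplexPoints Y) (2 * 1)

/-- `Transc[S, y]`: `y` is cup-orthogonal to `N¹(S) = algebraicClasses S 1`. -/
local notation3 (prettyPrint := false) "Transc[" S ", " y "]" =>
  (∀ d ∈ algebraicClasses S 1, cupProduct (rfl : 2 * 1 + 2 * 1 = 2 * 2) y d = 0)

/-! ### The transport theorem -/

set_option maxHeartbeats 400000 in
/-- **HC⁴(S ⊗ S) ⇒ HC⁴(S' ⊗ S') along ANY algebraic correspondence `Φ : H²(S) → H²(S')` with `Φ σ ≠ 0`**, for smooth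
projective surfaces `S`, `S'` with `(2,0)`-classes the lines `ℂσ`, `ℂσ'` — UNCONDITIONAL (no named fact). Proof: module
docstring. Nothing here proves the crux or HC. [cite: VoisinHodgeI2002, Lemma 7.25 and Lemma 11.41]
[cite: Zarhin1983HodgeGroupsK3, Thm. 1.5.1] [cite: Huybrechts2019, Rem. 3.3] [cite: Varesco2023, §2 (p. 8)] -/
theorem hodgeConjectureFor_square_of_algebraicCorrespondence₂
    (hS : IsSmoothProjective 2 S) {σ : complexBetti S (2 * 1)} (hσ : IsOfHodgeType 2 S (2 * 1) 2 0 σ) (hσ0 : σ ≠ 0)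
    (hline : ∀ c : complexBetti S (2 * 1), IsOfHodgeType 2 S (2 * 1) 2 0 c → ∃ t : ℂ, c = t • σ)
    (hS' : IsSmoothProjective 2 S') {σ' : complexBetti S' (2 * 1)} (hσ' : IsOfHodgeType 2 S' (2 * 1) 2 0 σ')
    (hσ'0 : σ' ≠ 0) (hline' : ∀ c : complexBetti S' (2 * 1), IsOfHodgeType 2 S' (2 * 1) 2 0 c → ∃ t : ℂ, c = t • σ')
    (Φ : complexBetti S (2 * 1) →ₗ[ℂ] complexBetti S' (2 * 1)) (hΦ : IsAlgebraicCorrespondence 2 2 S' S Φ)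
    (hΦσ : Φ σ ≠ 0) (hHC : HodgeConjectureFor 4 (S ⊗ S)) : HodgeConjectureFor 4 (S' ⊗ S') := by
  classical
  haveI := BettiUniverse.finite hS (2 * 1); haveI := BettiUniverse.finite hS' (2 * 1)
  -- the presentations
  obtain ⟨T, P, ε, hT, htrS, hirr, hK3, -⟩ := exists_isTranscendentalPartBetti_trPart hS hσ hσ0 hline
  obtain ⟨T', P', ε', hT', htrS', hirr', hK3', -⟩ := exists_isTranscendentalPartBetti_trPart hS' hσ' hσ'0 hline'
  haveI := Module.Finite.of_injective T.toSubmodule.subtype T.toSubmodule.injective_subtype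
  haveI := Module.Finite.of_injective T'.toSubmodule.subtype T'.toSubmodule.injective_subtype
  have hσtr := transc_of_twoZero hS hσ
  obtain ⟨x₀, hx₀⟩ := exists_baseChange_eq_of_transc hS T hT hσtr
  have hx₀0 : x₀ ≠ 0 := by rintro rfl; exact hσ0 (by rw [← hx₀, map_zero, map_zero])
  -- the complexification equivalences
  let ΘS : (ℂ ⊗[ℚ] bettiCohomology S (2 * 1)) ≃ₗ[ℂ] complexBetti S (2 * 1) :=
    LinearEquiv.ofBijective (Θ[S]) ⟨ofRatClassBaseChange_injective _ _, ofRatClassBaseChange_surjective hS (2 * 1)⟩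
  have hΘS : ∀ x, ΘS x = Θ[S] x := fun _ => rfl
  have hΘS_symm : ∀ (c : ℂ) (w : bettiCohomology S (2 * 1)), ΘS.symm (c • ι[S] w) = c ⊗ₜ[ℚ] w := by
    intro c w
    apply ΘS.injective
    rw [LinearEquiv.apply_symm_apply, hΘS, ofRatClassBaseChange_tmul]
  let ΘX : (ℂ ⊗[ℚ] bettiCohomology S' (2 * 1)) ≃ₗ[ℂ] complexBetti S' (2 * 1) :=
    LinearEquiv.ofBijective (Θ[S']) ⟨ofRatClassBaseChange_injective _ _, ofRatClassBaseChange_surjective hS' (2 * 1)⟩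
  have hΘX : ∀ x, ΘX x = Θ[S'] x := fun _ => rfl
  have hΘX_symm : ∀ (c : ℂ) (w : bettiCohomology S' (2 * 1)), ΘX.symm (c • ι[S'] w) = c ⊗ₜ[ℚ] w := by
    intro c w
    apply ΘX.injective
    rw [LinearEquiv.apply_symm_apply, hΘX, ofRatClassBaseChange_tmul]
  -- step 1: rational descent of correspondences `S → S'` (with a RATIONAL witness)
  have hdescSX : ∀ (r : ℂ →ₗ[ℚ] ℚ) {f : complexBetti S (2 * 1) →ₗ[ℂ] complexBetti S' (2 * 1)},
      IsAlgebraicCorrespondence 2 2 S' S f → ∃ (a : Hom T.toHodgeStructure T'.toHodgeStructure)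
        (fa : complexBetti S (2 * 1) →ₗ[ℂ] complexBetti S' (2 * 1)), IsAlgebraicCorrespondence 2 2 S' S fa ∧
        (∀ y, IsRationalClass y → IsRationalClass (fa y)) ∧
        (∀ t : T.toSubmodule, fa (ι[S] (t : bettiCohomology S (2 * 1))) =
          ι[S'] ((a.toLinearMap t : T'.toSubmodule) : bettiCohomology S' (2 * 1))) ∧
        ∀ t : T.toSubmodule,
          TensorProduct.lid ℚ _ (r.rTensor _ (ΘX.symm (f (ι[S] (t : bettiCohomology S (2 * 1)))))) =
            ((a.toLinearMap t : T'.toSubmodule) : bettiCohomology S' (2 * 1)) := by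
    intro r f hf
    obtain ⟨e, hab, γ, hγ, rfl⟩ := IsAlgebraicCorrespondence.exists_eq_corrAction hS' hS hf
    suffices hc : ∀ c : ℂ, ∃ (a : Hom T.toHodgeStructure T'.toHodgeStructure)
        (fa : complexBetti S (2 * 1) →ₗ[ℂ] complexBetti S' (2 * 1)), IsAlgebraicCorrespondence 2 2 S' S fa ∧
        (∀ y, IsRationalClass y → IsRationalClass (fa y)) ∧
        (∀ t : T.toSubmodule, fa (ι[S] (t : bettiCohomology S (2 * 1))) =
          ι[S'] ((a.toLinearMap t : T'.toSubmodule) : bettiCohomology S' (2 * 1))) ∧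
        ∀ t : T.toSubmodule, TensorProduct.lid ℚ _ (r.rTensor _ (ΘX.symm
          (c • corrAction complexOrientationFamily hS' hS hab γ (ι[S] (t : bettiCohomology S (2 * 1)))))) =
          ((a.toLinearMap t : T'.toSubmodule) : bettiCohomology S' (2 * 1)) by
      obtain ⟨a, fa, hfa, hfaQ, hfat, hc1⟩ := hc 1
      exact ⟨a, fa, hfa, hfaQ, hfat, fun t => by rw [← hc1 t, one_smul]⟩
    have hγ' := (le_of_eq (supportedClasses_eq_span_isRationalClass (hS'.tensor_holds hS) (2 * e) e)) hγ
    clear hf hγ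
    induction hγ' using Submodule.span_induction with
    | mem γ hγQ =>
      intro c
      obtain ⟨a, ha⟩ := exists_homAlg_of_isRationalClass₂ hS hS' T hT T' hT' hab hγQ.2 hγQ.1
      refine ⟨(r c) • a, ((r c : ℚ) : ℂ) • corrAction complexOrientationFamily hS' hS hab γ,
        IsAlgebraicCorrespondence.smul hS' hS (isAlgebraicCorrespondence_corrAction_complex hS' hS hab (by norm_num) hγQ.2) _,
        fun y hy => ?_, fun t => ?_, fun t => ?_⟩
      · rw [LinearMap.smul_apply]
        exact (Arapura2006.isRationalClass_corrAction_complex hS' hS hab hγQ.1 hy).smul _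
      · rw [LinearMap.smul_apply, ha t, Hom.smul_toLinearMap, LinearMap.smul_apply, Submodule.coe_smul,
          Motives.ofRatClass_smul]
      · rw [ha t, hΘX_symm, lid_rTensor_tmul, Hom.smul_toLinearMap, LinearMap.smul_apply, Submodule.coe_smul]
    | zero =>
      intro c
      refine ⟨0, 0, isAlgebraicCorrespondence_zero hS' hS (e := 2) rfl (by norm_num), fun y _ => ?_, fun t => ?_,
        fun t => ?_⟩
      · rw [LinearMap.zero_apply]; exact IsRationalClass.zero
      · rw [LinearMap.zero_apply, Hom.zero_toLinearMap, LinearMap.zero_apply, Submodule.coe_zero, map_zero]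
      · rw [map_zero, LinearMap.zero_apply, smul_zero, map_zero, map_zero, map_zero, Hom.zero_toLinearMap,
          LinearMap.zero_apply, Submodule.coe_zero]
    | add γ γ' _ _ h₁ h₂ =>
      intro c
      obtain ⟨a, fa, hfa, hfaQ, hfat, hat⟩ := h₁ c
      obtain ⟨a', fa', hfa', hfaQ', hfat', hat'⟩ := h₂ c
      refine ⟨a + a', fa + fa', IsAlgebraicCorrespondence.add hS' hS hfa hfa', fun y hy => ?_, fun t => ?_, fun t => ?_⟩
      · rw [LinearMap.add_apply]; exact (hfaQ y hy).add (hfaQ' y hy)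
      · rw [LinearMap.add_apply, hfat, hfat', Hom.add_toLinearMap, LinearMap.add_apply, Submodule.coe_add, map_add]
      · rw [map_add, LinearMap.add_apply, smul_add, map_add, map_add, map_add, hat, hat', Hom.add_toLinearMap,
          LinearMap.add_apply, Submodule.coe_add]
    | smul c' γ _ h₁ =>
      intro c
      obtain ⟨a, fa, hfa, hfaQ, hfat, hat⟩ := h₁ (c * c')
      refine ⟨a, fa, hfa, hfaQ, hfat, fun t => ?_⟩
      rw [(corrAction complexOrientationFamily hS' hS hab).map_smul, LinearMap.smul_apply, smul_smul]
      exact hat t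
  -- a non-zero, hence injective, `a : T → T'` from `Φ σ ≠ 0`
  have hzero_orS : ∃ t₀ : T.toSubmodule, Φ (ι[S] (t₀ : bettiCohomology S (2 * 1))) ≠ 0 := by
    by_contra hall
    push Not at hall
    have hzero : ∀ x : ℂ ⊗[ℚ] T.toSubmodule, Φ (Θ[S] (T.toSubmodule.subtype.baseChange ℂ x)) = 0 := by
      intro x
      induction x using TensorProduct.induction_on with
      | zero => rw [map_zero, map_zero, map_zero]
      | tmul c t =>
        rw [LinearMap.baseChange_tmul, Submodule.subtype_apply, ofRatClassBaseChange_tmul, map_smul, hall t, smul_zero]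
      | add x y hx hy => rw [map_add, map_add, map_add, hx, hy, add_zero]
    exact hΦσ (by rw [← hx₀]; exact hzero x₀)
  obtain ⟨s₀, hs₀⟩ := hzero_orS
  have hξS : ΘX.symm (Φ (ι[S] (s₀ : bettiCohomology S (2 * 1)))) ≠ 0 := fun h0 =>
    hs₀ (by simpa only [LinearEquiv.apply_symm_apply, map_zero] using congrArg ΘX h0)
  obtain ⟨rS, hrS⟩ := exists_rat_retraction_ne_zero hξS
  obtain ⟨gT, f₁, hf₁, hf₁Q, hgT, hgr⟩ := hdescSX rS hΦ
  have hgT0 : gT.toLinearMap ≠ 0 := fun h0 => hrS (by rw [hgr, h0, LinearMap.zero_apply, Submodule.coe_zero])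
  have hginj : Function.Injective gT.toLinearMap := Hom.injective_of_ne_zero_of_isIrreducible hirr gT hgT0
  -- `f₁ σ ≠ 0` is a `(2,0)`-class and `f₁` is real
  have hψx : ∀ x : ℂ ⊗[ℚ] T.toSubmodule, f₁ (Θ[S] (T.toSubmodule.subtype.baseChange ℂ x)) =
      Θ[S'] (T'.toSubmodule.subtype.baseChange ℂ (gT.toLinearMap.baseChange ℂ x)) := by
    intro x
    induction x using TensorProduct.induction_on with
    | zero => simp only [map_zero]
    | tmul c t =>
      rw [LinearMap.baseChange_tmul, Submodule.subtype_apply, ofRatClassBaseChange_tmul, map_smul,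
        LinearMap.baseChange_tmul, LinearMap.baseChange_tmul, Submodule.subtype_apply, ofRatClassBaseChange_tmul, hgT]
    | add x y hx hy => simp only [map_add, hx, hy]
  have hf₁σ0 : f₁ σ ≠ 0 := by
    rw [← hx₀, hψx]
    exact fun h0 => hx₀0 (baseChange_injective_of_injective hginj
      (baseChange_injective_of_injective T'.toSubmodule.injective_subtype
        (ofRatClassBaseChange_injective _ _ (by rw [h0, map_zero, map_zero, map_zero]))))
  obtain ⟨Ψ₁, hΨ₁⟩ := exists_ratLinear_ofRatClass_eq₂ (S' := S') f₁ hf₁Q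
  -- step 2: the Lefschetz–transpose `R : H²(S') → H²(S)` of `f₁`, non-vanishing at the period
  obtain ⟨R, hRid, -, hne⟩ := exists_lefschetzTranspose₂ hS' hS hS' (le_refl 2)
    (isAlgebraicCorrespondence_id hS' (a := 2 * 1) (by norm_num)) hf₁
  have hR : IsAlgebraicCorrespondence 2 2 S S' R := by simpa only [LinearMap.comp_id] using hRid
  have hconj : f₁ (conjClass _ (2 * 1) σ) = conjClass _ (2 * 1) (f₁ σ) := by
    obtain ⟨w, hw⟩ := ofRatClassBaseChange_surjective hS (2 * 1) σ
    rw [← hw, ← ofRatClassBaseChange_conj_eq hS w, ← ofRatClassBaseChange_baseChange_eq₂ hΨ₁ (HodgeStructure.conj w),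
      ← ofRatClassBaseChange_baseChange_eq₂ hΨ₁ w, ← ofRatClassBaseChange_conj_eq hS' (Ψ₁.baseChange ℂ w), conj_baseChange]
  have hRσ : (R ∘ₗ f₁) σ ≠ 0 :=
    hne σ (isOfHodgeType_two_zero_of_isAlgebraicCorrespondence hS' hS hf₁ hσ) hf₁σ0 hconj
  have hzero_or : ∃ t₀ : T.toSubmodule, R (f₁ (ι[S] (t₀ : bettiCohomology S (2 * 1)))) ≠ 0 := by
    by_contra hall
    push Not at hall
    have hzero : ∀ x : ℂ ⊗[ℚ] T.toSubmodule, R (f₁ (Θ[S] (T.toSubmodule.subtype.baseChange ℂ x))) = 0 := by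
      intro x
      induction x using TensorProduct.induction_on with
      | zero => rw [map_zero, map_zero, map_zero, map_zero]
      | tmul c t =>
        rw [LinearMap.baseChange_tmul, Submodule.subtype_apply, ofRatClassBaseChange_tmul, map_smul, map_smul, hall t,
          smul_zero]
      | add x y hx hy => rw [map_add, map_add, map_add, map_add, hx, hy, add_zero]
    exact hRσ (by rw [LinearMap.comp_apply, ← hx₀]; exact hzero x₀)
  obtain ⟨t₀, ht₀⟩ := hzero_or
  -- the cycle-induced Hodge endomorphisms of `T'` (self-correspondences of `S'`)
  let Rs : Submodule ℚ (Module.End ℚ T'.toSubmodule) :=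
    { carrier := {a | a ∈ T'.toHodgeStructure.endAlg ∧
        ∃ f : complexBetti S' (2 * 1) →ₗ[ℂ] complexBetti S' (2 * 1), IsAlgebraicCorrespondence 2 2 S' S' f ∧
          ∀ t : T'.toSubmodule, f (ι[S'] (t : bettiCohomology S' (2 * 1))) =
            ι[S'] ((a t : T'.toSubmodule) : bettiCohomology S' (2 * 1))}
      add_mem' := by
        rintro a a' ⟨haE, f, hf, hfa⟩ ⟨hbE, f', hf', hfb⟩
        refine ⟨add_mem haE hbE, f + f', IsAlgebraicCorrespondence.add hS' hS' hf hf', fun t => ?_⟩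
        rw [LinearMap.add_apply, hfa, hfb, LinearMap.add_apply, Submodule.coe_add, map_add]
      zero_mem' := by
        refine ⟨zero_mem _, 0, isAlgebraicCorrespondence_zero hS' hS' (e := 2) rfl (by norm_num), fun t => ?_⟩
        rw [LinearMap.zero_apply, LinearMap.zero_apply, Submodule.coe_zero, map_zero]
      smul_mem' := by
        rintro c a ⟨haE, f, hf, hfa⟩
        refine ⟨Subalgebra.smul_mem _ haE c, (c : ℂ) • f, IsAlgebraicCorrespondence.smul hS' hS' hf _, fun t => ?_⟩
        rw [LinearMap.smul_apply, hfa, LinearMap.smul_apply, Submodule.coe_smul, Motives.ofRatClass_smul] }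
  have hRsE : ∀ a ∈ Rs, a ∈ T'.toHodgeStructure.endAlg := fun a ha => ha.1
  have hRsmul : ∀ a ∈ Rs, ∀ a' ∈ Rs, a * a' ∈ Rs := by
    rintro a ⟨haE, f, hf, hfa⟩ a' ⟨hbE, f', hf', hfb⟩
    refine ⟨mul_mem haE hbE, f ∘ₗ f', IsAlgebraicCorrespondence.comp hS' hS' hS' hf' hf (by norm_num), fun t => ?_⟩
    rw [LinearMap.comp_apply, hfb, hfa, Module.End.mul_apply]
  -- rational descent of `R` to `bT : T' → T` induced by correspondences `S' → S`, `bT (g_T t₀) ≠ 0`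
  have hdescX : ∀ (r : ℂ →ₗ[ℚ] ℚ) {f : complexBetti S' (2 * 1) →ₗ[ℂ] complexBetti S (2 * 1)},
      IsAlgebraicCorrespondence 2 2 S S' f → ∃ (a : Hom T'.toHodgeStructure T.toHodgeStructure)
        (fa : complexBetti S' (2 * 1) →ₗ[ℂ] complexBetti S (2 * 1)), IsAlgebraicCorrespondence 2 2 S S' fa ∧
        (∀ t : T'.toSubmodule, fa (ι[S'] (t : bettiCohomology S' (2 * 1))) =
          ι[S] ((a.toLinearMap t : T.toSubmodule) : bettiCohomology S (2 * 1))) ∧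
        ∀ t : T'.toSubmodule,
          TensorProduct.lid ℚ _ (r.rTensor _ (ΘS.symm (f (ι[S'] (t : bettiCohomology S' (2 * 1)))))) =
            ((a.toLinearMap t : T.toSubmodule) : bettiCohomology S (2 * 1)) := by
    intro r f hf
    obtain ⟨e, hab, γ, hγ, rfl⟩ := IsAlgebraicCorrespondence.exists_eq_corrAction hS hS' hf
    suffices hc : ∀ c : ℂ, ∃ (a : Hom T'.toHodgeStructure T.toHodgeStructure)
        (fa : complexBetti S' (2 * 1) →ₗ[ℂ] complexBetti S (2 * 1)), IsAlgebraicCorrespondence 2 2 S S' fa ∧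
        (∀ t : T'.toSubmodule, fa (ι[S'] (t : bettiCohomology S' (2 * 1))) =
          ι[S] ((a.toLinearMap t : T.toSubmodule) : bettiCohomology S (2 * 1))) ∧
        ∀ t : T'.toSubmodule, TensorProduct.lid ℚ _ (r.rTensor _ (ΘS.symm
          (c • corrAction complexOrientationFamily hS hS' hab γ (ι[S'] (t : bettiCohomology S' (2 * 1)))))) =
          ((a.toLinearMap t : T.toSubmodule) : bettiCohomology S (2 * 1)) by
      obtain ⟨a, fa, hfa, hfat, hc1⟩ := hc 1
      exact ⟨a, fa, hfa, hfat, fun t => by rw [← hc1 t, one_smul]⟩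
    have hγ' := (le_of_eq (supportedClasses_eq_span_isRationalClass (hS.tensor_holds hS') (2 * e) e)) hγ
    clear hf hγ
    induction hγ' using Submodule.span_induction with
    | mem γ hγQ =>
      intro c
      obtain ⟨a, ha⟩ := exists_homAlg_of_isRationalClass₂ hS' hS T' hT' T hT hab hγQ.2 hγQ.1
      refine ⟨(r c) • a, ((r c : ℚ) : ℂ) • corrAction complexOrientationFamily hS hS' hab γ,
        IsAlgebraicCorrespondence.smul hS hS' (isAlgebraicCorrespondence_corrAction_complex hS hS' hab (by norm_num) hγQ.2) _,
        fun t => ?_, fun t => ?_⟩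
      · rw [LinearMap.smul_apply, ha t, Hom.smul_toLinearMap, LinearMap.smul_apply, Submodule.coe_smul,
          Motives.ofRatClass_smul]
      · rw [ha t, hΘS_symm, lid_rTensor_tmul, Hom.smul_toLinearMap, LinearMap.smul_apply, Submodule.coe_smul]
    | zero =>
      intro c
      refine ⟨0, 0, isAlgebraicCorrespondence_zero hS hS' (e := 2) rfl (by norm_num), fun t => ?_, fun t => ?_⟩
      · rw [LinearMap.zero_apply, Hom.zero_toLinearMap, LinearMap.zero_apply, Submodule.coe_zero, map_zero]
      · rw [map_zero, LinearMap.zero_apply, smul_zero, map_zero, map_zero, map_zero, Hom.zero_toLinearMap,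
          LinearMap.zero_apply, Submodule.coe_zero]
    | add γ γ' _ _ h₁ h₂ =>
      intro c
      obtain ⟨a, fa, hfa, hfat, hat⟩ := h₁ c
      obtain ⟨a', fa', hfa', hfat', hat'⟩ := h₂ c
      refine ⟨a + a', fa + fa', IsAlgebraicCorrespondence.add hS hS' hfa hfa', fun t => ?_, fun t => ?_⟩
      · rw [LinearMap.add_apply, hfat, hfat', Hom.add_toLinearMap, LinearMap.add_apply, Submodule.coe_add, map_add]
      · rw [map_add, LinearMap.add_apply, smul_add, map_add, map_add, map_add, hat, hat', Hom.add_toLinearMap,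
          LinearMap.add_apply, Submodule.coe_add]
    | smul c' γ _ h₁ =>
      intro c
      obtain ⟨a, fa, hfa, hfat, hat⟩ := h₁ (c * c')
      refine ⟨a, fa, hfa, hfat, fun t => ?_⟩
      rw [(corrAction complexOrientationFamily hS hS' hab).map_smul, LinearMap.smul_apply, smul_smul]
      exact hat t
  have hξ : ΘS.symm (R (ι[S'] ((gT.toLinearMap t₀ : T'.toSubmodule) : bettiCohomology S' (2 * 1)))) ≠ 0 := fun h0 =>
    ht₀ (by rw [hgT]; simpa only [LinearEquiv.apply_symm_apply, map_zero] using congrArg ΘS h0)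
  obtain ⟨r, hr⟩ := exists_rat_retraction_ne_zero hξ
  obtain ⟨bT, fb, hfb, hfbt, hbr⟩ := hdescX r hR
  have hbT0 : bT.toLinearMap ≠ 0 := fun h0 => hr (by rw [hbr, h0, LinearMap.zero_apply, Submodule.coe_zero])
  have hbinj : Function.Injective bT.toLinearMap := Hom.injective_of_ne_zero_of_isIrreducible hirr' bT hbT0
  -- step 3: `u = g_T ∘ bT ∈ E(S')`, cycle-induced (`f₁ ∘ fb`) and injective; the field `E(S')`
  set u : Hom T'.toHodgeStructure T'.toHodgeStructure := gT.comp bT with hu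
  have huR : u.toLinearMap ∈ Rs := by
    refine ⟨Hom.toLinearMap_mem_endAlg u, f₁ ∘ₗ fb, IsAlgebraicCorrespondence.comp hS' hS hS' hfb hf₁ (by norm_num),
      fun t => ?_⟩
    rw [LinearMap.comp_apply, hfbt, hgT]
    rfl
  have huinj : Function.Injective u.toLinearMap := hginj.comp hbinj
  obtain ⟨hFieldX, -⟩ := Zarhin1983_endAlg_isField_holds T'.toHodgeStructure hirr' hK3'
  -- the cycle-induced sector clause of `S'`
  refine hodgeConjectureFor_square_of_cycleInducedSector complexOrientationFamily hS' ?_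
  intro f hf1 hf2 hf3 hf4
  obtain ⟨fT, hfT⟩ := exists_hom_transcendental hS' T' hT' f hf1 hf2 hf4
  obtain ⟨W, hW, hWt⟩ := exists_corr_eq_of_mem_endAlg_of_hodgeConjectureFor_square hS hσ hσ0 hline htrS hHC
    (Hom.toLinearMap_mem_endAlg (bT.comp (fT.comp gT)))
  have hcR : (u.comp (fT.comp u)).toLinearMap ∈ Rs := by
    refine ⟨Hom.toLinearMap_mem_endAlg _, f₁ ∘ₗ (W ∘ₗ fb),
      IsAlgebraicCorrespondence.comp hS' hS hS' (IsAlgebraicCorrespondence.comp hS hS hS' hfb hW (by norm_num)) hf₁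
        (by norm_num), fun t => ?_⟩
    rw [LinearMap.comp_apply, LinearMap.comp_apply, hfbt, hWt, hgT]
    rfl
  have hcomm : u.toLinearMap * fT.toLinearMap = fT.toLinearMap * u.toLinearMap := by
    have h := hFieldX.mul_comm ⟨u.toLinearMap, Hom.toLinearMap_mem_endAlg u⟩ ⟨fT.toLinearMap, Hom.toLinearMap_mem_endAlg fT⟩
    exact congrArg Subtype.val h
  have hrel : (u.toLinearMap * u.toLinearMap) * fT.toLinearMap = (u.comp (fT.comp u)).toLinearMap := by
    rw [mul_assoc, hcomm, ← mul_assoc]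
    rfl
  have hfTR : fT.toLinearMap ∈ Rs := by
    by_cases hf0 : fT.toLinearMap = 0
    · rw [hf0]; exact Rs.zero_mem
    · have hfinj : Function.Injective fT.toLinearMap := Hom.injective_of_ne_zero_of_isIrreducible hirr' fT hf0
      have hc0 : (u.comp (fT.comp u)).toLinearMap ≠ 0 := by
        intro h0
        have hinj3 : Function.Injective (u.comp (fT.comp u)).toLinearMap := huinj.comp (hfinj.comp huinj)
        obtain ⟨t, ht⟩ := (Submodule.ne_bot_iff _).1 (Submodule.nontrivial_iff_ne_bot.1 hirr'.1)
        exact ht.2 (congrArg Subtype.val (hinj3 (a₁ := ⟨t, ht.1⟩) (a₂ := 0) (by rw [h0, map_zero, LinearMap.zero_apply])))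
      exact mem_of_mul_eq_of_isField hFieldX Rs hRsE hRsmul hcR (hRsmul _ huR _ huR) (Hom.toLinearMap_mem_endAlg fT)
        hc0 hrel
  obtain ⟨-, F, hF, hFt⟩ := hfTR
  -- `F = [γ]_*`, `N¹`-stable, `= f` on `T(S')_ℂ`
  obtain ⟨e, hab, γ, hγ, hFγ⟩ := IsAlgebraicCorrespondence.exists_eq_corrAction hS' hS' hF
  obtain rfl : e = 2 := by omega
  refine ⟨F, fun d hd => ?_, ⟨γ, hγ, fun y => by rw [hFγ]; rfl⟩, fun y hy => ?_⟩
  · rw [← map_hodgeClasses_baseChange_eq_algebraicClasses hS'] at hd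
    obtain ⟨v, hv, rfl⟩ := hd
    obtain ⟨v', rfl⟩ := hv
    induction v' using TensorProduct.induction_on with
    | zero => rw [map_zero, map_zero, map_zero]; exact Submodule.zero_mem _
    | tmul c n =>
      rw [LinearMap.baseChange_tmul, Submodule.subtype_apply, ofRatClassBaseChange_tmul, map_smul, hFγ]
      exact Submodule.smul_mem _ c (corrAction_ofRatClass_mem_algebraicClasses hS' hab hγ n.2)
    | add x y hx hy => rw [map_add, map_add, map_add]; exact Submodule.add_mem _ hx hy
  · obtain ⟨x, rfl⟩ := exists_baseChange_eq_of_transc hS' T' hT' hy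
    clear hy
    induction x using TensorProduct.induction_on with
    | zero => rw [map_zero, map_zero, map_zero, map_zero]
    | tmul c t =>
      rw [LinearMap.baseChange_tmul, Submodule.subtype_apply, ofRatClassBaseChange_tmul, map_smul, map_smul, hFt t, hfT t]
    | add x y hx hy => rw [map_add, map_add, map_add, map_add, hx, hy]

end Summit.HodgeConjecture.HodgeConjecture.Theorems.MarkmanPartnerTransport.SquareTransport

end
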